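import Literature.NumberTheory.EllipticCurves.FormalGroupFrobeniusTypeAllPrimesProofs
import Literature.NumberTheory.EllipticCurves.FormalGroupMultiplicationUniversalProofs
import Literature.NumberTheory.EllipticCurves.FormalGroupNegProofs
import Literature.NumberTheory.EllipticCurves.PadicSigma
import Literature.NumberTheory.GaloisRepresentations.LubinTate
import HarnessLib

/-!
# The Hasse invariant is the trace of Frobenius mod `p`: `A_p(E) = a_p(E)` in `𝔽_p` for an elliptic curve
# `E/𝔽_p`, `p` odd (Silverman AEC V.4.1(a); proofs only)

`Proofs`-style file (THEOREMS ONLY: no definition, no named fact, no instance), topic `NumberTheory/EllipticCurves`,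
closing the gap recorded in `FormalGroupVerschiebungHasseZeroProofs` ("What is NOT here: the identification
`A_p = 0 ⟺ p ∣ a` with the trace of Frobenius") and claimed without proof in the docstring of
`FormalGroupHasseInvariantProofs` (`hasseCoeff`: "over `𝔽_p` it is the Hasse invariant and `A ≡ a_p (mod p)`").

For an elliptic curve `E` over `𝔽_p = ZMod p` with formal group law `F̄`, `[p]‾ = g(Xᵖ)` with
`g = formalMulFrobPart E p` the reduced Verschiebung (`formalMul_prime_eq_expand_of_charP`), and `a = HasseManin.tr E`
(`a = p + 1 − #E(𝔽_p)`):
* (private `exists_padicInt_lift`) `isElliptic_map_coe_of_isElliptic_map_toZMod` — a coefficientwise lift `V/ℤ_p` of `E` has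
  elliptic generic fibre (so the tree's Frobenius identity `F̄(X^{p²}, [p]‾) = [a]‾(Xᵖ)` for curves over `ℤ_p`,
  `frobenius_formal_identity_of_nonneg'/_of_neg'`, i.e. Manin's `π² − aπ + p = 0`, applies to `E`);
* **`subst_pair_X_pow_formalMulFrobPart_eq_formalMul`** (`a ≥ 0`) / **`…_eq_formalNeg_subst`** (`a < 0`):
  `F̄(Xᵖ, g) = [a]‾` resp. `= ī([|a|]‾)` — the identity is `(F̄(Xᵖ, g))(Xᵖ) = [a]‾(Xᵖ)` and `X ↦ Xᵖ` is injective;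
* **`coeff_one_formalMulFrobPart_eq_intCast_tr`**: `g'(0) = a` in `𝔽_p` (linear terms; `Xᵖ` has none), EVERY prime `p`;
* **`hasseCoeff_eq_intCast_tr`** (`p` odd): `hasseCoeff E p = a` in `𝔽_p`, by Katz–Mazur 12.4.2 `g'(0) ≡ A_p`
  (`coeff_one_formalMulFrobPart_sub_hasseCoeff_mem_span`); **`hasseCoeff_eq_zero_iff`**: `A_p(E) = 0 ⟺ p ∣ a`
  (supersingular ⟺ `a_p ≡ 0`).

References: [cite: SilvermanAEC2009, Thm. V.4.1(a), IV.4.4, V.2.3.1(b)] · [cite: KatzMazur1985, 12.4.2] · [cite: Honda1970, §6.2].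
-/

noncomputable section

open PowerSeries Literature.NumberTheory.EllipticCurves Literature.NumberTheory.GaloisRepresentations

namespace WeierstrassCurve

section Lift

variable {p : ℕ} [hp : Fact p.Prime]

/-- **Coefficientwise `ℤ_p`-lift of a Weierstrass equation over `𝔽_p`** (lift every `aᵢ` by its digit). [folklore] -/
private theorem exists_padicInt_lift (E : WeierstrassCurve (ZMod p)) :
    ∃ V : WeierstrassCurve ℤ_[p], V.map PadicInt.toZMod = E := by
  refine ⟨⟨(E.a₁.val : ℤ_[p]), (E.a₂.val : ℤ_[p]), (E.a₃.val : ℤ_[p]), (E.a₄.val : ℤ_[p]), (E.a₆.val : ℤ_[p])⟩, ?_⟩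
  ext <;> simp [WeierstrassCurve.map]

/-- A `ℤ_p`-equation with elliptic special fibre has elliptic generic fibre (`Δ` is a `p`-adic unit).
[cite: SilvermanAEC2009, VII.5.1] -/
theorem isElliptic_map_coe_of_isElliptic_map_toZMod (V : WeierstrassCurve ℤ_[p])
    [hV : (V.map PadicInt.toZMod).IsElliptic] : (V.map PadicInt.Coe.ringHom).IsElliptic := by
  refine ⟨?_⟩
  rw [WeierstrassCurve.map_Δ, isUnit_iff_ne_zero]
  intro h0
  have hΔ : V.Δ = 0 := (PadicInt.coe_eq_zero (p := p)).mp h0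
  have h := hV.isUnit
  rw [WeierstrassCurve.map_Δ, hΔ, map_zero] at h
  exact not_isUnit_zero h

end Lift

section Hasse

variable {p : ℕ} [hp : Fact p.Prime]

/-- `expand` is injective on one-variable series. [folklore] -/
private theorem eq_of_expand_eq {R : Type*} [CommRing R] {q : ℕ} (hq : q ≠ 0) {f g : R⟦X⟧}
    (h : expand q hq f = expand q hq g) : f = g := by
  ext n
  have := congrArg (coeff (q * n)) h
  rwa [coeff_expand_mul, coeff_expand_mul] at this

/-- The linear coefficient of `X₁` in the chord–tangent law is `1` (any ring): from `F(0, X) = X`.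
[cite: SilvermanAEC2009, IV.2.1] -/
theorem coeff_single_one_formalGroupLaw_eq_one {R : Type*} [CommRing R] (W : WeierstrassCurve R) :
    MvPowerSeries.coeff (Finsupp.single (1 : Fin 2) 1) W.formalGroupLaw = 1 := by
  have h := congrArg (coeff 1) W.formalGroupLaw_subst_zero_X
  rw [coeff_one_X] at h
  have e := LubinTate.coeff_single_subst (F := W.formalGroupLaw) (b := ![(0 : R⟦X⟧), PowerSeries.X])
    (fun j => by
      fin_cases j
      · exact map_zero _
      · exact PowerSeries.constantCoeff_X) ()
  rw [Fin.sum_univ_two] at e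
  simp only [Matrix.cons_val_zero, Matrix.cons_val_one, map_zero, mul_zero, zero_add] at e
  rw [show MvPowerSeries.coeff (Finsupp.single () 1) (PowerSeries.X : R⟦X⟧) = 1 from coeff_one_X, mul_one] at e
  rw [← e]; exact h

/-- Linear coefficient of `F(u, v)` for one-variable `u, v` without constant term: `u'(0)·F₁₀ + v'(0)`; with `u = Xᵠ`,
`q ≥ 2`, this is `v'(0)`. [cite: SilvermanAEC2009, IV.2.1] -/
theorem coeff_one_subst_pair_X_pow {R : Type*} [CommRing R] (W : WeierstrassCurve R) {q : ℕ} (hq : 2 ≤ q)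
    {v : R⟦X⟧} (hv : constantCoeff v = 0) :
    coeff 1 (MvPowerSeries.subst ![(PowerSeries.X : R⟦X⟧) ^ q, v] W.formalGroupLaw) = coeff 1 v := by
  have hq0 : q ≠ 0 := by omega
  have hXq : constantCoeff ((PowerSeries.X : R⟦X⟧) ^ q) = 0 := by rw [map_pow, constantCoeff_X, zero_pow hq0]
  have e := LubinTate.coeff_single_subst (F := W.formalGroupLaw) (b := ![(PowerSeries.X : R⟦X⟧) ^ q, v])
    (fun j => by fin_cases j <;> assumption) ()
  rw [Fin.sum_univ_two, coeff_single_one_formalGroupLaw_eq_one, one_mul] at e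
  simp only [Matrix.cons_val_zero, Matrix.cons_val_one] at e
  rw [show MvPowerSeries.coeff (Finsupp.single () 1) ((PowerSeries.X : R⟦X⟧) ^ q) = 0 by
    rw [show MvPowerSeries.coeff (Finsupp.single () 1) ((PowerSeries.X : R⟦X⟧) ^ q) = coeff 1 ((PowerSeries.X : R⟦X⟧) ^ q)
      from rfl, coeff_X_pow, if_neg (by omega)], mul_zero, zero_add] at e
  exact e

/-- `(F(Xᵖ, v))(Xᵖ) = F(X^{p²}, v(Xᵖ))`. [folklore] -/
private theorem subst_X_pow_subst_pair {R : Type*} [CommRing R] (W : WeierstrassCurve R) {q : ℕ} (hq : q ≠ 0)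
    {v : R⟦X⟧} (hv : constantCoeff v = 0) :
    PowerSeries.subst ((PowerSeries.X : R⟦X⟧) ^ q) (MvPowerSeries.subst ![(PowerSeries.X : R⟦X⟧) ^ q, v] W.formalGroupLaw) =
      MvPowerSeries.subst ![(PowerSeries.X : R⟦X⟧) ^ q ^ 2, v.subst ((PowerSeries.X : R⟦X⟧) ^ q)] W.formalGroupLaw := by
  have hXq : constantCoeff ((PowerSeries.X : R⟦X⟧) ^ q) = 0 := by rw [map_pow, constantCoeff_X, zero_pow hq]
  rw [PowerSeries.subst_def, MvPowerSeries.subst_comp_subst_apply (hasSubst_pair hXq hv)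
    (PowerSeries.HasSubst.X_pow hq).const]
  congr 1
  funext i
  fin_cases i
  · show PowerSeries.subst ((PowerSeries.X : R⟦X⟧) ^ q) ((PowerSeries.X : R⟦X⟧) ^ q) = (PowerSeries.X : R⟦X⟧) ^ q ^ 2
    rw [PowerSeries.subst_pow (PowerSeries.HasSubst.X_pow hq), PowerSeries.subst_X (PowerSeries.HasSubst.X_pow hq),
      ← pow_mul, sq]
  · rfl

variable (E : WeierstrassCurve (ZMod p)) [hEl : E.IsElliptic]

/-- **`F̄(Xᵖ, g) = [a]‾`** (`a = HasseManin.tr E ≥ 0`, `g = formalMulFrobPart E p` the reduced Verschiebung, `[p]‾ = g(Xᵖ)`):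
the Frobenius identity `F̄(X^{p²}, [p]‾) = [a]‾(Xᵖ)` of a `ℤ_p`-lift, and injectivity of `X ↦ Xᵖ`. Every prime `p`.
[cite: SilvermanAEC2009, Thm. V.2.3.1(b) and IV.4.4] [cite: Honda1970, §6.2] -/
theorem subst_pair_X_pow_formalMulFrobPart_eq_formalMul
    (ha : 0 ≤ Literature.NumberTheory.EllipticCurves.HasseManin.tr E) :
    MvPowerSeries.subst ![(PowerSeries.X : (ZMod p)⟦X⟧) ^ p, E.formalMulFrobPart p] E.formalGroupLaw =
      E.formalMul (Literature.NumberTheory.EllipticCurves.HasseManin.tr E).toNat := by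
  obtain ⟨V, rfl⟩ := exists_padicInt_lift E
  haveI := isElliptic_map_coe_of_isElliptic_map_toZMod V
  set Eb := V.map PadicInt.toZMod with hEb
  have hp0 : p ≠ 0 := hp.out.ne_zero
  have hg0 : constantCoeff (Eb.formalMulFrobPart p) = 0 := Eb.constantCoeff_formalMulFrobPart p
  have hid := V.frobenius_formal_identity_of_nonneg' ha
  rw [← hEb, PowerSeries.X_subst] at hid
  refine eq_of_expand_eq hp0 ?_
  rw [expand_apply, expand_apply, subst_X_pow_subst_pair Eb hp0 hg0, ← expand_apply p hp0,
    ← formalMul_prime_eq_expand_of_charP p Eb]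
  exact hid

/-- The same for `a < 0`: `F̄(Xᵖ, g) = ī([|a|]‾)`. [cite: SilvermanAEC2009, Thm. V.2.3.1(b) and IV.4.4] -/
theorem subst_pair_X_pow_formalMulFrobPart_eq_formalNeg_subst
    (ha : Literature.NumberTheory.EllipticCurves.HasseManin.tr E < 0) :
    MvPowerSeries.subst ![(PowerSeries.X : (ZMod p)⟦X⟧) ^ p, E.formalMulFrobPart p] E.formalGroupLaw =
      E.formalNeg.subst (E.formalMul (Literature.NumberTheory.EllipticCurves.HasseManin.tr E).natAbs) := by
  obtain ⟨V, rfl⟩ := exists_padicInt_lift E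
  haveI := isElliptic_map_coe_of_isElliptic_map_toZMod V
  set Eb := V.map PadicInt.toZMod with hEb
  have hp0 : p ≠ 0 := hp.out.ne_zero
  have hg0 : constantCoeff (Eb.formalMulFrobPart p) = 0 := Eb.constantCoeff_formalMulFrobPart p
  have hm0 : constantCoeff (Eb.formalMul (Literature.NumberTheory.EllipticCurves.HasseManin.tr Eb).natAbs) = 0 :=
    Eb.constantCoeff_formalMul _
  have hid := V.frobenius_formal_identity_of_neg' ha
  rw [← hEb, PowerSeries.X_subst] at hid
  refine eq_of_expand_eq hp0 ?_
  rw [expand_apply, expand_apply, subst_X_pow_subst_pair Eb hp0 hg0, ← expand_apply p hp0,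
    ← formalMul_prime_eq_expand_of_charP p Eb,
    PowerSeries.subst_comp_subst_apply (PowerSeries.HasSubst.of_constantCoeff_zero' hm0) (PowerSeries.HasSubst.X_pow hp0)]
  exact hid

/-- **`g'(0) = a_p` in `𝔽_p`** for the reduced Verschiebung `g = formalMulFrobPart E p` of an elliptic curve `E/𝔽_p`
(every prime `p`): compare linear terms in `F̄(Xᵖ, g) = [a]‾`. [cite: SilvermanAEC2009, IV.4.4 and V.4.1(a)] -/
theorem coeff_one_formalMulFrobPart_eq_intCast_tr :
    coeff 1 (E.formalMulFrobPart p) = ((Literature.NumberTheory.EllipticCurves.HasseManin.tr E : ℤ) : ZMod p) := by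
  set a := Literature.NumberTheory.EllipticCurves.HasseManin.tr E with hadef
  have hg0 : constantCoeff (E.formalMulFrobPart p) = 0 := E.constantCoeff_formalMulFrobPart p
  have hlin := coeff_one_subst_pair_X_pow E hp.out.two_le hg0
  rcases le_or_gt 0 a with ha | ha
  · rw [subst_pair_X_pow_formalMulFrobPart_eq_formalMul E ha, E.coeff_one_formalMul', ← hadef] at hlin
    rw [← hlin, show ((a.toNat : ℕ) : ZMod p) = ((a.toNat : ℤ) : ZMod p) by rw [Int.cast_natCast], Int.toNat_of_nonneg ha]
  · rw [subst_pair_X_pow_formalMulFrobPart_eq_formalNeg_subst E ha, ← hadef] at hlin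
    have e := LubinTate.coeff_single_subst (F := E.formalNeg) (b := fun _ : Unit => E.formalMul a.natAbs)
      (fun _ => E.constantCoeff_formalMul _) ()
    rw [Fintype.sum_unique] at e
    have e' : coeff 1 (E.formalNeg.subst (E.formalMul a.natAbs)) = coeff 1 E.formalNeg * coeff 1 (E.formalMul a.natAbs) := by
      rw [PowerSeries.subst_def]; exact e
    rw [e', E.coeff_one_formalNeg, E.coeff_one_formalMul'] at hlin
    rw [← hlin, show ((a.natAbs : ℕ) : ZMod p) = ((|a| : ℤ) : ZMod p) by rw [← Int.natCast_natAbs, Int.cast_natCast],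
      abs_of_neg ha]
    push_cast; ring

/-- **THE HASSE INVARIANT IS THE TRACE OF FROBENIUS MOD `p`** (`p` odd): `A_p(E) = a_p(E)` in `𝔽_p` for every elliptic
curve `E/𝔽_p`, where `A_p = hasseCoeff E p` (Deuring's coefficient of `x^{p−1}` in `Ψ₂²^{(p−1)/2}`) and
`a_p = p + 1 − #E(𝔽_p)` (`HasseManin.tr`). Katz–Mazur 12.4.2 (`g'(0) ≡ A_p`) + `g'(0) = a_p`.
[cite: SilvermanAEC2009, Thm. V.4.1(a)] [cite: KatzMazur1985, 12.4.2] -/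
theorem hasseCoeff_eq_intCast_tr (hp2 : p ≠ 2) :
    E.hasseCoeff p = ((Literature.NumberTheory.EllipticCurves.HasseManin.tr E : ℤ) : ZMod p) := by
  have h := E.coeff_one_formalMulFrobPart_sub_hasseCoeff_mem_span p hp2
  rw [show Ideal.span {((p : ℕ) : ZMod p)} = ⊥ by rw [ZMod.natCast_self, Ideal.span_singleton_zero],
    Ideal.mem_bot, sub_eq_zero, coeff_one_formalMulFrobPart_eq_intCast_tr E] at h
  exact h.symm

/-- **Supersingular ⟺ `a_p ≡ 0 (mod p)`** (`p` odd): the Hasse invariant of `E/𝔽_p` vanishes iff `p` divides the trace of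
Frobenius. [cite: SilvermanAEC2009, Thm. V.4.1(a) and Ex. V.5.10] -/
theorem hasseCoeff_eq_zero_iff_dvd_tr (hp2 : p ≠ 2) :
    E.hasseCoeff p = 0 ↔ (p : ℤ) ∣ Literature.NumberTheory.EllipticCurves.HasseManin.tr E := by
  rw [hasseCoeff_eq_intCast_tr E hp2, ZMod.intCast_zmod_eq_zero_iff_dvd]

end Hasse

end WeierstrassCurve

end
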